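import Literature.AlgebraicGeometry.Resolution.FBlowupUnique
import Mathlib.AlgebraicGeometry.Morphisms.IsIso
import HarnessLib

/-!
# The F-blowup at level zero is the identity: `FB_0(X) = X`

Topic: `Literature/AlgebraicGeometry/Resolution`. A consistency check of the definition
`IsFBlowup` (`FBlowup.lean`) against Yasuda's convention "`X = FB_0(X)`" (T. Yasuda, *Universal
flattening of Frobenius*, Amer. J. Math. 134 (2012), Introduction: "Given a variety, we obtain a
sequence of blowups `X = FB_0(X), FB_1(X), FB_2(X), …`"). At level `e = 0` one has `q = p^0 = 1`,
`K^q = K`, `𝒪_X^{1/q} = 𝒪_X`, and the Frobenius norm `[[F^0_* A]] = A` is the unit ideal, whose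
blow-up is the identity. All PROVED:

* `isFrobeniusNormIdeal_top_of_zero` — the unit ideal of any `A → K` is a level-`0` Frobenius
  norm ideal (basis `{1}` of `K` over `K^1 = K`);
* `isFBlowup_id_zero` — **the identity of `X` is a `0`-th F-blowup** (non-vacuity of the
  definition at the scheme level, for every integral scheme of characteristic `p`);
* `IsFBlowup.isIso_of_zero` — **every `0`-th F-blowup is an isomorphism** (an F-blowup is a
  blowing up along every representative, `IsFBlowup.isBlowup_of_isFrobeniusNormIdeal`; blowing up
  the unit ideal is an isomorphism; being an isomorphism is local on the target).

## Sources

* T. Yasuda, Amer. J. Math. 134 (2012) = arXiv:0706.2700, Introduction and Def. 2.2. [Yasuda2012]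
* U. Görtz, T. Wedhorn, *Algebraic Geometry I*, remark after Def. 13.90 (blowing up an effective
  Cartier divisor, e.g. the empty one, is an isomorphism). [GortzWedhorn2020]
-/

noncomputable section

open CategoryTheory CategoryTheory.Limits AlgebraicGeometry TopologicalSpace Module

namespace Literature.AlgebraicGeometry.Resolution

universe u

/-! ## Level zero: the unit ideal is a Frobenius norm ideal -/

section Algebra

variable (K : Type u) [Field K] (p : ℕ) [ExpChar K p] (A : Type*) [CommRing A] [Algebra A K]

/-- At level `0` every element of `K` is a `q`-th power (`q = p^0 = 1`). [folklore] -/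
theorem mem_iterateFrobeniusRange_zero (x : K) : x ∈ iterateFrobeniusRange K p 0 :=
  mem_iterateFrobeniusRange_iff.mpr ⟨x, by rw [pow_zero, pow_one]⟩

/-- The basis `{1}` of `K` over `K^1 = K`. [folklore] -/
def basisOneZero : Basis (Fin 1) (iterateFrobeniusRange K p 0) K :=
  Basis.mk (v := fun _ => (1 : K))
    (linearIndependent_unique_iff.mpr one_ne_zero)
    (by
      rintro x -
      have hx : x = (⟨x, mem_iterateFrobeniusRange_zero K p x⟩ : iterateFrobeniusRange K p 0) •
          (fun _ : Fin 1 => (1 : K)) 0 := by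
        rw [Algebra.smul_def, Subfield.algebraMap_ofSubfield, mul_one]
        rfl
      rw [hx]
      exact Submodule.smul_mem _ _ (Submodule.subset_span ⟨0, rfl⟩))

/-- The determinant of a `1`-tuple with respect to the basis `{1}` is its entry. [folklore] -/
theorem det_basisOneZero (v : Fin 1 → K) :
    (((basisOneZero K p).det v : iterateFrobeniusRange K p 0) : K) = v 0 := by
  rw [Basis.det_apply, Matrix.det_fin_one, Basis.toMatrix_apply]
  have hv : v 0 = (⟨v 0, mem_iterateFrobeniusRange_zero K p (v 0)⟩ : iterateFrobeniusRange K p 0) •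
      basisOneZero K p 0 := by
    rw [basisOneZero, Basis.mk_apply, Algebra.smul_def, Subfield.algebraMap_ofSubfield, mul_one]
    rfl
  conv_lhs => rw [hv, map_smul, Basis.repr_self, Finsupp.smul_apply, Finsupp.single_eq_same,
    smul_eq_mul, mul_one]

/-- At level `0` the Frobenius norm set of `A` with respect to `{1}` is the image of `A` in `K`.
[folklore] -/
theorem frobeniusNormSet_basisOneZero :
    frobeniusNormSet (basisOneZero K p) A = Set.range (algebraMap A K) := by
  ext d
  rw [mem_frobeniusNormSet_iff]
  constructor
  · rintro ⟨m, hm⟩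
    rw [pow_zero, pow_one, det_basisOneZero] at hm
    exact ⟨m 0, hm.symm⟩
  · rintro ⟨a, rfl⟩
    refine ⟨fun _ => a, ?_⟩
    rw [pow_zero, pow_one, det_basisOneZero]

/-- **At level `0` the unit ideal is a Frobenius norm ideal**: `[[F^0_* A]] = A` (with respect to
the basis `{1}` of `K` over `K^1 = K`). [cite: Yasuda2012, Introduction ("`X = FB_0(X)`")] -/
theorem isFrobeniusNormIdeal_top_of_zero : IsFrobeniusNormIdeal K p 0 (⊤ : Ideal A) := by
  refine ⟨Fin 1, inferInstance, inferInstance, basisOneZero K p, ?_⟩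
  rw [IsLocalization.coeSubmodule_top, Submodule.one_eq_range, frobeniusNorm,
    frobeniusNormSet_basisOneZero]
  have hr : Set.range (algebraMap A K) = (LinearMap.range (Algebra.linearMap A K) : Set K) := by
    rw [LinearMap.coe_range]
    rfl
  rw [hr, Submodule.span_eq]

end Algebra

/-! ## `FB_0(X) = X` -/

/-- The ideal sheaf of the unit ideal is the unit ideal sheaf (a private copy of the statement
`affineBlowup.idealSheaf_top` of `KollarFunctorLinearCentre.lean`, to keep the imports light).
[folklore] -/
private theorem idealSheaf_top' {R : Type u} [CommRing R] :
    affineBlowup.idealSheaf (⊤ : Ideal R) = ⊤ := by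
  apply Scheme.IdealSheafData.ext_of_isAffine
  rw [affineBlowup.idealSheaf, ideal_ofIdealTop_top, Ideal.map_top,
    Scheme.IdealSheafData.ideal_top, Pi.top_apply]

variable {p : ℕ} {X : Scheme.{u}} [IsIntegral X] [ExpChar X.functionField p]

/-- **The identity is a `0`-th F-blowup** (`X = FB_0(X)`): over every nonempty affine open the
unit ideal is a level-`0` Frobenius norm ideal, and the identity is a blowing up along the unit
ideal sheaf (the empty subscheme is an effective Cartier divisor). In particular the notion
`IsFBlowup` is inhabited over every integral scheme of characteristic `p`.
[cite: Yasuda2012, Introduction ("`X = FB_0(X)`") and Def. 2.2] -/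
theorem isFBlowup_id_zero : IsFBlowup p 0 (𝟙 X) := by
  refine ⟨fun U _ => ⟨⊤, isFrobeniusNormIdeal_top_of_zero X.functionField p Γ(X, U), ?_⟩⟩
  rw [idealSheaf_top']
  have h := (IsBlowup.id (isEffectiveCartier_top (X := Spec Γ(X, U)))).iso_comp U.2.isoSpec
  rw [Category.comp_id] at h
  have e1 : 𝟙 X ∣_ (U : X.Opens) ≫ U.2.isoSpec.hom = U.2.isoSpec.hom := by
    rw [morphismRestrict_id]
    exact Category.id_comp _
  rw [e1]
  exact h

/-- **Every `0`-th F-blowup is an isomorphism** (`FB_0(X) = X`): an F-blowup is a blowing up,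
over each nonempty affine open, along the ideal sheaf of every level-`0` Frobenius norm ideal,
e.g. the unit ideal, and blowing up the unit ideal is an isomorphism; being an isomorphism is
local on the target. [cite: Yasuda2012, Introduction ("`X = FB_0(X)`") and Def. 2.2] -/
theorem IsFBlowup.isIso_of_zero {Y : Scheme.{u}} {π : Y ⟶ X} (h : IsFBlowup p 0 π) : IsIso π := by
  have hP : (MorphismProperty.isomorphisms Scheme) π := by
    refine IsZariskiLocalAtTarget.of_iSup_eq_top (P := MorphismProperty.isomorphisms Scheme)
      (fun U : {U : X.affineOpens // Nonempty (U : X.Opens)} => (U.1 : X.Opens)) ?_ fun U => ?_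
    · rw [eq_top_iff]
      rintro x -
      obtain ⟨U, hxU⟩ := IsFBlowup.exists_affineOpens_mem x
      exact Opens.mem_iSup.mpr ⟨⟨U, ⟨⟨x, hxU⟩⟩⟩, hxU⟩
    · obtain ⟨U, hU⟩ := U
      have hb := h.isBlowup_of_isFrobeniusNormIdeal U
        (isFrobeniusNormIdeal_top_of_zero X.functionField p Γ(X, U))
      rw [idealSheaf_top'] at hb
      haveI : IsIso (π ∣_ (U : X.Opens) ≫ U.2.isoSpec.hom) := hb.isIso isEffectiveCartier_top
      exact (MorphismProperty.isomorphisms.iff _).mpr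
        (IsIso.of_isIso_comp_right (π ∣_ (U : X.Opens)) U.2.isoSpec.hom)
  exact (MorphismProperty.isomorphisms.iff _).mp hP

end Literature.AlgebraicGeometry.Resolution

end
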